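import Summits.QuantumFields.YangMills.Theorems.FradkinShenkerFlowSusceptibilityToPoincareBisectionScales
import Literature.MathematicalPhysics.QuantumFieldTheory.LatticeGaugeProofs

/-!
# Stub `stub_bisection` of the line `maxcorr-halving` (crux `SusceptibilityToPoincare`)

Route `FradkinShenkerFlow` of `YangMills`, crux item `stmt-QuantumFields-9441`
(`Summit.QuantumFields.YangMills.Theses.FradkinShenkerFlow.SusceptibilityToPoincare`, FS ⇒ UP).
This file proves stub C4 of the registered skeleton `Cruxes/SusceptibilityToPoincare/Lines/
maxcorr-halving.lean`: **Martinelli's bisection in maximal-correlation currency**.  For the torus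
Wilson measure `μ = wilsonMeasure r.ρ β` on `(ℤ/(2S+1))⁴`, write `P_D = E_μ[· | cylinderEvents D]`,
call `Q(a,n) = {x | ∀ ν, (x ν - a ν).val < n ν}` a cylinder, `K(Q) = {ℓ | ℓ.1 ∉ Q}` its exterior and
`hb_Q(F) = Σ_ℓ 1[ℓ.1 ∈ Q] ∫∫ (F U - F(U[ℓ ↦ g]))² dν_ℓ^U dμ` the heat-bath form of the links based in
`Q`.  Then

  two-block factorisation (C1) → box decoupling (C2, data `R ≥ 1`, `ρ < 1`) →
  local Poincaré inequality for small cylinders (C3) → UP: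
  `∃ C ∀ S ∀ bounded measurable F, Var_μ F ≤ C · hb_univ(F)`.

## Proof

Fix `S` and `F` and put `v(Λ) = E(F - P_{K(Λ)} F)²`.
* *Two-block step* (inline): for a cylinder `Q` and the sets `X, Z` of C2 one has
  `K ∪ X = K(Λ₂)`, `K ∪ Z = K(Λ₁)` for the two children `Λ₁, Λ₂` of the cut
  (`Bisect.exterior_union_eq`), so C1 fed with C2 reads `v Q ≤ (1-δ)⁻² (v Λ₂ + v Λ₁)`
  (`δ = ρ` for a ring cut, `δ = ρ^{m/2}` for a corridor of `m` slabs).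
* *Boxes and rings* (registered sub-goal `stub_bisection_recursion`, file `…BisectionScales`):
  Martinelli's scale recursion with the explicit scales of `…BisectionGeometry`
  (`l k = R(2k³+12k²+36k+52)`, `(k+1)²` corridor positions of `2(k+1)` slabs, product of step
  factors `≤ exp (2ρ/(1-ρ)²+2)`, registered sub-goal `stub_bisection_stepFactors`), started from
  C3 with `m = 52 R`, bounds every box with interval sides by `Γ_box hb_Q(F)`; for `2R ≤ S` the
  four ring directions are then opened one at a time (factor `2(1-ρ)⁻²` each), so
  `v univ ≤ (2(1-ρ)⁻²)⁴ Γ_box hb_univ(F)`; for `S < 2R` the whole torus is a small cylinder and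
  C3 applies directly.
* *Conclusion*: `K(univ) = ∅`, `cylinderEvents ∅ = ⊥`, `P_⊥ F = E F` (`condExp_bot`), so
  `v univ = Var_μ F` (`variance_eq_integral`); the constant is uniform in `S`.

Sources: Martinelli, *Lectures on Glauber dynamics for discrete spin models* (Saint-Flour 1997,
LNM 1717) Thm. 4.5; Martinelli–Olivieri, CMP 161 (1994); Cesi, PTRF 120 (2001).
-/

noncomputable section

open MeasureTheory ProbabilityTheory
open Literature.MathematicalPhysics.QuantumFieldTheory

namespace Summit.QuantumFields.YangMills.Theorems.SusceptibilityToPoincare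

namespace Bisect

/-- The exterior of a child of a cut: `K(Q) ∪ {links of Q based where p} = K({x ∈ Q | ¬ p x})`.
[folklore] -/
theorem exterior_union_eq {d L : ℕ} (Q : Set (Site d L)) (p : Site d L → Prop) :
    {ℓ : Edge d L | ℓ.1 ∉ Q} ∪ {ℓ | ℓ.1 ∈ Q ∧ p ℓ.1} = {ℓ | ℓ.1 ∉ {x | x ∈ Q ∧ ¬ p x}} := by
  ext ℓ
  simp only [Set.mem_union, Set.mem_setOf_eq, not_and, not_not]
  tauto

/-- On the whole torus the exterior is empty and `E(F - P_{K(univ)} F)² = Var F`. [folklore] -/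
theorem integral_sub_condExp_exterior_univ_sq {d L : ℕ} {G : Type} [MeasurableSpace G]
    (μ : Measure (GaugeConfig d L G)) [IsProbabilityMeasure μ] {F : GaugeConfig d L G → ℝ}
    (hF : Measurable F) :
    ∫ U, (F U - condExp (cylinderEvents {ℓ : Edge d L | ℓ.1 ∉ (Set.univ : Set (Site d L))}) μ F U)
      ^ 2 ∂μ = variance F μ := by
  have hK : {ℓ : Edge d L | ℓ.1 ∉ (Set.univ : Set (Site d L))} = ∅ := by
    ext ℓ; simp
  have hbot : cylinderEvents (X := fun _ : Edge d L => G) (∅ : Set (Edge d L)) = ⊥ := by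
    simp [cylinderEvents]
  rw [variance_eq_integral hF.aemeasurable, hK, hbot, condExp_bot]

end Bisect

open Bisect in
/-- **Stub C4 `stub_bisection` — Martinelli's bisection in maximal-correlation currency.**
For every compact group `G`, lattice representation `r` and real `β`: the two-block
factorisation (C1) → `BoxDecoupling r β` (C2) → `LocalPoincareSmall r β` (C3) → the uniform
single-link heat-bath Poincaré inequality UP(r, β) for the torus Wilson measures.
[folklore] -/
theorem stub_bisection :
    ∀ (G : Type) [Group G] [TopologicalSpace G] [IsTopologicalGroup G] [CompactSpace G]
      [MeasurableSpace G] [BorelSpace G] (r : LatticeRep G) (β : ℝ),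
      (∀ (S : ℕ) (μ : Measure (GaugeConfig 4 (2 * S + 1) G)) [IsProbabilityMeasure μ]
        (K D₁ D₂ : Set (Edge 4 (2 * S + 1))), K ⊆ D₁ → K ⊆ D₂ → ∀ ρ : ℝ, 0 ≤ ρ → ρ < 1 →
        (∀ h : GaugeConfig 4 (2 * S + 1) G → ℝ, Measurable h → (∃ M : ℝ, ∀ U, |h U| ≤ M) →
          ∫ U, (condExp (cylinderEvents D₁) μ (condExp (cylinderEvents D₂) μ h) U
              - condExp (cylinderEvents K) μ h U) ^ 2 ∂μ ≤
            ρ ^ 2 * ∫ U, (h U - condExp (cylinderEvents K) μ h U) ^ 2 ∂μ) →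
        ∀ F : GaugeConfig 4 (2 * S + 1) G → ℝ, Measurable F → (∃ M : ℝ, ∀ U, |F U| ≤ M) →
        ∫ U, (F U - condExp (cylinderEvents K) μ F U) ^ 2 ∂μ ≤
          (1 / (1 - ρ) ^ 2) * ((∫ U, (F U - condExp (cylinderEvents D₁) μ F U) ^ 2 ∂μ) +
            ∫ U, (F U - condExp (cylinderEvents D₂) μ F U) ^ 2 ∂μ)) →
      (∃ R : ℕ, 1 ≤ R ∧ ∃ ρ : ℝ, 0 ≤ ρ ∧ ρ < 1 ∧ ∀ (S : ℕ) (μW : Measure (GaugeConfig 4 (2 * S + 1) G)),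
        μW = (wilsonMeasure r.ρ β : Measure (GaugeConfig 4 (2 * S + 1) G)) →
        ∀ (a : Fin 4 → ZMod (2 * S + 1)) (n : Fin 4 → ℕ), (∀ ν, n ν ≤ 2 * S + 1) →
        ∀ (Q : Set (Site 4 (2 * S + 1))), Q = {x | ∀ ν, (x ν - a ν).val < n ν} →
        ∀ (K : Set (Edge 4 (2 * S + 1))), K = {ℓ | ℓ.1 ∉ Q} →
        ∀ (i : Fin 4),
        (n i = 2 * S + 1 → 2 * R ≤ S → ∀ (b : ZMod (2 * S + 1)) (X Z : Set (Edge 4 (2 * S + 1))),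
          X = {ℓ | ℓ.1 ∈ Q ∧ (ℓ.1 i - b).val < R} →
          Z = {ℓ | ℓ.1 ∈ Q ∧ (ℓ.1 i - b - (S : ZMod (2 * S + 1))).val < R} →
          ∀ f : GaugeConfig 4 (2 * S + 1) G → ℝ, Measurable f → (∃ M : ℝ, ∀ U, |f U| ≤ M) →
          ∫ U, (condExp (cylinderEvents (K ∪ X)) μW (condExp (cylinderEvents (K ∪ Z)) μW f) U
              - condExp (cylinderEvents K) μW f U) ^ 2 ∂μW ≤
            ρ ^ 2 * ∫ U, (f U - condExp (cylinderEvents K) μW f U) ^ 2 ∂μW) ∧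
        (n i ≤ 2 * S → ∀ (c m : ℕ), R ≤ c → ∀ (X Z : Set (Edge 4 (2 * S + 1))),
          X = {ℓ | ℓ.1 ∈ Q ∧ (ℓ.1 i - a i).val < c} →
          Z = {ℓ | ℓ.1 ∈ Q ∧ c + m * R ≤ (ℓ.1 i - a i).val} →
          ∀ f : GaugeConfig 4 (2 * S + 1) G → ℝ, Measurable f → (∃ M : ℝ, ∀ U, |f U| ≤ M) →
          ∫ U, (condExp (cylinderEvents (K ∪ X)) μW (condExp (cylinderEvents (K ∪ Z)) μW f) U
              - condExp (cylinderEvents K) μW f U) ^ 2 ∂μW ≤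
            (ρ ^ (m / 2)) ^ 2 * ∫ U, (f U - condExp (cylinderEvents K) μW f U) ^ 2 ∂μW)) →
      (∀ m : ℕ, ∃ C : ℝ, ∀ (S : ℕ) (μW : Measure (GaugeConfig 4 (2 * S + 1) G)),
        μW = (wilsonMeasure r.ρ β : Measure (GaugeConfig 4 (2 * S + 1) G)) →
        ∀ (a : Fin 4 → ZMod (2 * S + 1)) (n : Fin 4 → ℕ), (∀ ν, n ν ≤ m) → (∀ ν, n ν ≤ 2 * S + 1) →
        ∀ (Q : Set (Site 4 (2 * S + 1))), Q = {x | ∀ ν, (x ν - a ν).val < n ν} →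
        ∀ F : GaugeConfig 4 (2 * S + 1) G → ℝ, Measurable F → (∃ M : ℝ, ∀ U, |F U| ≤ M) →
        ∫ U, (F U - condExp (cylinderEvents {ℓ : Edge 4 (2 * S + 1) | ℓ.1 ∉ Q}) μW F U) ^ 2 ∂μW ≤
          C * ∑ ℓ : Edge 4 (2 * S + 1), Set.indicator {ℓ : Edge 4 (2 * S + 1) | ℓ.1 ∈ Q}
            (fun ℓ => ∫ U, ∫ g, (F U - F (Function.update U ℓ g)) ^ 2
              ∂((haarProbability G).tilted (fun g' => -β * wilsonAction r.ρ (Function.update U ℓ g'))) ∂μW) ℓ) →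
      ∃ C : ℝ, ∀ S : ℕ, ∀ F : GaugeConfig 4 (2 * S + 1) G → ℝ, Measurable F → (∃ M : ℝ, ∀ U, |F U| ≤ M) →
        variance F (wilsonMeasure r.ρ β : Measure (GaugeConfig 4 (2 * S + 1) G)) ≤
          C * ∑ ℓ : Edge 4 (2 * S + 1), ∫ U, ∫ g, (F U - F (Function.update U ℓ g)) ^ 2
            ∂((haarProbability G).tilted (fun g' => -β * wilsonAction r.ρ (Function.update U ℓ g')))
            ∂(wilsonMeasure r.ρ β : Measure (GaugeConfig 4 (2 * S + 1) G)) := by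
  intro G _ _ _ _ _ _ r β h1 h2 h3
  obtain ⟨R, hR, ρ, hρ, hρ1, hbd⟩ := h2
  obtain ⟨C₀, hC₀⟩ := h3 (52 * R)
  -- the constant: `Γ₀ = max C₀ 0` (base), `exp (2ρ/(1-ρ)² + 2)` (scales), `(2(1-ρ)⁻²)⁴` (rings)
  refine ⟨max (max C₀ 0) ((2 / (1 - ρ) ^ 2) ^ 4 *
    (max C₀ 0 * Real.exp (2 * ρ / (1 - ρ) ^ 2 + 2) ^ 4)), fun S F hF hFb => ?_⟩
  set μ : Measure (GaugeConfig 4 (2 * S + 1) G) := wilsonMeasure r.ρ β with hμW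
  haveI : IsProbabilityMeasure μ :=
    hμW ▸ isProbabilityMeasure_wilsonMeasure (d := 4) (L := 2 * S + 1) r.ρ r.continuous β
  -- the variance functional of a site set and the heat-bath weight of a link
  set v : Set (Site 4 (2 * S + 1)) → ℝ := fun Λ =>
    ∫ U, (F U - condExp (cylinderEvents {ℓ : Edge 4 (2 * S + 1) | ℓ.1 ∉ Λ}) μ F U) ^ 2 ∂μ with hv
  set e : Edge 4 (2 * S + 1) → ℝ := fun ℓ => ∫ U, ∫ g, (F U - F (Function.update U ℓ g)) ^ 2
    ∂((haarProbability G).tilted (fun g' => -β * wilsonAction r.ρ (Function.update U ℓ g'))) ∂μ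
    with he
  have he0 : ∀ ℓ, 0 ≤ e ℓ := fun ℓ =>
    integral_nonneg fun U => integral_nonneg fun g => sq_nonneg _
  have hsum0 : 0 ≤ ∑ ℓ, e ℓ := Finset.sum_nonneg fun ℓ _ => he0 ℓ
  -- base: C3 on cylinders with all sides `≤ 52 R`
  have hbase : ∀ (a : Fin 4 → ZMod (2 * S + 1)) (n : Fin 4 → ℕ), (∀ ν, n ν ≤ 52 * R) →
      (∀ ν, n ν ≤ 2 * S + 1) →
      v {x | ∀ ν, (x ν - a ν).val < n ν} ≤ max C₀ 0 *
        ∑ ℓ, {ℓ : Edge 4 (2 * S + 1) | ℓ.1 ∈ {x | ∀ ν, (x ν - a ν).val < n ν}}.indicator e ℓ :=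
    fun a n hn hnL => (hC₀ S μ hμW a n hn hnL _ rfl F hF hFb).trans
      (mul_le_mul_of_nonneg_right (le_max_left _ _) (hb_nonneg e he0 _))
  rw [← integral_sub_condExp_exterior_univ_sq μ hF]
  change v Set.univ ≤ _
  by_cases hS : 2 * R ≤ S
  · -- ring decoupling: C1 fed with the ring clause of C2
    have hring : ∀ (a : Fin 4 → ZMod (2 * S + 1)) (n : Fin 4 → ℕ), (∀ ν, n ν ≤ 2 * S + 1) →
        ∀ Q : Set (Site 4 (2 * S + 1)), Q = {x | ∀ ν, (x ν - a ν).val < n ν} →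
        ∀ i, n i = 2 * S + 1 → ∀ b : ZMod (2 * S + 1),
        v Q ≤ 1 / (1 - ρ) ^ 2 * (v {x | x ∈ Q ∧ R ≤ (x i - b).val} +
          v {x | x ∈ Q ∧ R ≤ (x i - b - (S : ZMod (2 * S + 1))).val}) := by
      intro a n hn Q hQ i hi b
      have htb := (hbd S μ hμW a n hn Q hQ _ rfl i).1 hi hS b _ _ rfl rfl
      have h := h1 S μ {ℓ | ℓ.1 ∉ Q} _ _ Set.subset_union_left Set.subset_union_left ρ hρ hρ1
        htb F hF hFb
      rw [exterior_union_eq Q (fun x => (x i - b).val < R),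
        exterior_union_eq Q (fun x => (x i - b - (S : ZMod (2 * S + 1))).val < R)] at h
      simpa only [not_lt] using h
    -- corridor decoupling: C1 fed with the corridor clause of C2
    have hcorr : ∀ (a : Fin 4 → ZMod (2 * S + 1)) (n : Fin 4 → ℕ), (∀ ν, n ν ≤ 2 * S + 1) →
        ∀ Q : Set (Site 4 (2 * S + 1)), Q = {x | ∀ ν, (x ν - a ν).val < n ν} →
        ∀ i, n i ≤ 2 * S → ∀ c m' : ℕ, R ≤ c → 2 ≤ m' →
        v Q ≤ 1 / (1 - ρ ^ (m' / 2)) ^ 2 *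
          (v {x | x ∈ Q ∧ c ≤ (x i - a i).val} +
            v {x | x ∈ Q ∧ (x i - a i).val < c + m' * R}) := by
      intro a n hn Q hQ i hi c m' hRc hm'
      have hδ0 : 0 ≤ ρ ^ (m' / 2) := pow_nonneg hρ _
      have hδ1 : ρ ^ (m' / 2) < 1 := pow_lt_one₀ hρ hρ1 (by omega)
      have htb := (hbd S μ hμW a n hn Q hQ _ rfl i).2 hi c m' hRc _ _ rfl rfl
      have h := h1 S μ {ℓ | ℓ.1 ∉ Q} _ _ Set.subset_union_left Set.subset_union_left _ hδ0 hδ1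
        htb F hF hFb
      rw [exterior_union_eq Q (fun x => (x i - a i).val < c),
        exterior_union_eq Q (fun x => c + m' * R ≤ (x i - a i).val)] at h
      simpa only [not_lt, not_le] using h
    -- the abstract bisection (registered sub-goal `stub_bisection_recursion`)
    exact (stub_bisection_recursion S R ρ (max C₀ 0) v e hR hS hρ hρ1 (le_max_right _ _) he0
      hring hcorr hbase).trans (mul_le_mul_of_nonneg_right (le_max_right _ _) hsum0)
  · -- small torus: the whole torus is a cylinder with all sides `2S+1 ≤ 52 R`
    have h := hbase 0 (fun _ => 2 * S + 1) (fun _ => by omega) (fun _ => le_rfl)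
    rw [cyl_eq_univ (0 : Fin 4 → ZMod (2 * S + 1)) (fun _ => 2 * S + 1) (fun _ => rfl),
      hb_univ] at h
    exact h.trans (mul_le_mul_of_nonneg_right (le_max_left _ _) hsum0)

end Summit.QuantumFields.YangMills.Theorems.SusceptibilityToPoincare
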